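import Summits.BirchSwinnertonDyer.BirchSwinnertonDyer.Theses.DerivedKatoValuationDoor
import Literature.NumberTheory.EllipticCurves.Kato2004.MainConjecturePrimeTDoorOfInputs
import HarnessLib

/-!
# Route `DerivedKatoValuationDoor`, support item `KatoMainConjecturePrimeTOfDoor` (stmt-BirchSwinnertonDyer-23260,
# child 2 of the split of crux `DerivedKatoDoor` stmt-23024): the item BY NAME from its three printed inputs —
# its OPEN CONTENT displayed honestly (helper; `--supports stmt-BirchSwinnertonDyer-23260`)

Stub worker `bsd-line-dkd-w2` (g1), on director-bsd's PRECISION of 2026-08-28T21:22:47Z («land the by-name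
reduction as a Theorems helper `--supports 23260 --as helper`, so the item's open content is displayed honestly;
do NOT chase 23260 this session»). THEOREMS ONLY; nothing new is proved here: the file re-exports, at the route
decl `Summit.BirchSwinnertonDyer.BirchSwinnertonDyer.Theses.DerivedKatoValuationDoor.KatoMainConjecturePrimeTOfDoor`
(= `Kato2004.kato_mainConjecture_primeT_of_door` by definition), the Literature assembly
`Kato2004.kato_mainConjecture_primeT_of_door_of_bcs_of_clause_of_h2`
(`Literature/NumberTheory/EllipticCurves/Kato2004/MainConjecturePrimeTDoorOfInputs.lean`, input seat; companion
`MainConjecturePrimeTDoorProofs.lean`, `GeneratorChange.lean`).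

WHAT THE ITEM IS CLOSED MODULO (exactly; none of the three is provable now — this item does NOT close):
* `hBCS : burungale_castella_skinner_charIdeal_eq_padicLFunction` — Burungale–Castella–Skinner 2025 Thm. 1.1.2 (a)
  (cyclotomic IMC `ch_Λ X(E/ℚ_∞) = (L_p)` in `Λ ⊗ ℚ_p` for `p > 3` good ordinary with (irr_ℚ)); tree NAMED FACT,
  no `_holds` (Kato's Euler-system divisibility + the Skinner–Urban/Wan/BCS converse).
* `hH2 : exists_iwasawaH2Data_fineSelmerDual_embedding` — Kato (14.9.1)/(17.13.1): Kato's `𝐇²_Γ(T_pW)` as a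
  descent package over every pin with the Poitou–Tate embedding `X₀(E/ℚ_∞) ↪ J.H2` of finite cokernel; tree
  NAMED FACT, no `_holds` (XL construction; = stub F1 of line `descent` on the sibling crux 23259).
* `hX` — Kato's §17.13 package `DivisibilityInputs W p f κ γ I D` WITH the surjective fine quotient
  `π : X ↠ X₀` (exact after `P → X`) AND the admissible localisation clause «for every admissible `z₀` and every
  height-one `𝔭`: `Z_𝔭 = (Λ z₀)_𝔭`» (Kato Thm. 12.6 + Thm. 12.5 (1)(4) + 13.9–13.12; Thm. 16.6 (2) on the
  pinned family). An INLINE hypothesis (not a tree declaration); only `𝔭 = (T)` is consumed. Given the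
  package's injective `col ∘ loc : 𝐇¹ ↪ Λ`, the clause at `(T)` is equivalent to «`ord_T col(loc z₀) =
  ord_T L_p(E,T)` for admissible `z₀`» for the PACKAGE's Coleman map — not derivable from the abstract package
  (its `Z` is only bounded above by the span of Euler-system classes, its `col` is existential).
Imai 1975 (finiteness of `E(ℚ_{p,∞})[p^∞]` at a good ordinary `p ≥ 5`) is DISCHARGED inside the Literature
assembly by the tree theorem `WeierstrassCurve.finite_fixedPoints_kerSubgroup_inf_decomp_of_ordinary`.

HONEST FRAMING. CONDITIONAL on the three displayed inputs; no `sorry`; nothing about BSD, the crux 23259 or its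
parent 23024 is advanced. With the sibling crux `FineLengthLeOneOfAnalyticRankTwo` (23259) this item glues to the
parent by `DerivedKatoDoorGlueBy_holds`.

References: K. Kato, Astérisque 295 (2004), Conj. 12.10 (p. 224), Thm. 12.5–12.6 (pp. 221–222), (14.9.1)
(p. 239), Thm. 16.6 (p. 271), §17.13 (pp. 279–280) [Kato2004Asterisque]; A. Burungale, F. Castella, C. Skinner,
IMRN 2025 = arXiv:2405.00270v2, Thm. 1.1.2 (a) [BurungaleCastellaSkinner2025]; H. Imai, Proc. Japan Acad. 51
(1975), Theorem p. 12 [Imai1975]; L. C. Washington, GTM 83, §13.2 [Washington1997].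
-/

-- D-0017: single-problem summit, so `Summit.BirchSwinnertonDyer.BirchSwinnertonDyer.…` repeats a
-- namespace BY DESIGN.
set_option linter.dupNamespace false

noncomputable section

namespace Summit.BirchSwinnertonDyer.BirchSwinnertonDyer.Theorems.DerivedKatoValuationDoor

open scoped NumberField
open Field CongruenceSubgroup IsDedekindDomain
open Literature.NumberTheory.GaloisRepresentations
open Literature.NumberTheory.EllipticCurves Literature.NumberTheory.EllipticCurves.ModularForms
open Literature.NumberTheory.EllipticCurves.Kato2004

/-- **Item stmt-BirchSwinnertonDyer-23260 `KatoMainConjecturePrimeTOfDoor` BY NAME from its three printed inputs**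
(`hBCS` = BCS 2025 Thm. 1.1.2 (a), tree named fact; `hX` = Kato's §17.13 package with fine quotient and the
admissible localisation clause, inline; `hH2` = Kato (14.9.1) `𝐇² ⊇ X₀` embedding, tree named fact): Kato's
Conj. 12.10 at `𝔭 = (T)` for `T_pW` at a door prime — for every cyclotomic datum `K`, topological generator `γ`
and pin `I`, a descent package `J` with `X₀ ↪ J.H2` of finite cokernel and `ℓ_T(J.H2) = ℓ_T(I.H/Λz₀)` for every
admissible `z₀`. The proof IS the Literature theorem `kato_mainConjecture_primeT_of_door_of_bcs_of_clause_of_h2`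
(the route decl unfolds to the named fact). CONDITIONAL on the three inputs; the item stays open.
[cite: Kato2004Asterisque, Conj. 12.10 (p. 224), §17.13 (pp. 279–280), Thm. 12.6 (p. 222), (14.9.1) (p. 239)]
[cite: BurungaleCastellaSkinner2025, Thm. 1.1.2 (a)] [cite: Imai1975, Theorem (p. 12)] -/
theorem katoMainConjecturePrimeTOfDoor_of_bcs_of_clause_of_h2
    (hBCS : burungale_castella_skinner_charIdeal_eq_padicLFunction)
    (hX : ∀ (W : WeierstrassCurve ℚ) [W.IsElliptic] [W.IsGloballyMinimal] (p : ℕ) [Fact p.Prime]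
      [ContinuousSMul ℤ_[p] (W.tateModule p)] {N : ℕ} [NeZero N] (f : CuspForm (Gamma0 N) 2)
      (κ : ZpExtension ℚ p) (γ : absoluteGaloisGroup ℚ) (hκ : κ.IsCyclotomic),
      p ≠ 2 → IsOrdinaryAt W p → κ.IsTopGenerator γ → IsCyclotomicVariable p γ → IsNewformOf W f →
      ∀ (I : IwasawaH1Data W p κ γ) (D : W.SelmerDualData κ γ) (Y : W.FineSelmerDualData κ γ),
        ∃ (K : DivisibilityInputs W p f κ γ I D) (π : D.X →ₗ[IwasawaAlgebra p] Y.X),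
          Function.Surjective π ∧ Function.Exact K.toX π ∧
          (W.HasIrreducibleModPGaloisRep p → ∀ z₀ : I.H, IsAdmissibleZetaClass W p κ hκ I z₀ →
            ∀ 𝔭 : PrimeSpectrum (IwasawaAlgebra p), 𝔭.asIdeal.height = 1 →
              ∃ s : IwasawaAlgebra p, s ∉ 𝔭.asIdeal ∧ s • z₀ ∈ K.Z ∧
                ∀ z ∈ K.Z, s • z ∈ Submodule.span (IwasawaAlgebra p) {z₀}))
    (hH2 : exists_iwasawaH2Data_fineSelmerDual_embedding) :
    Summit.BirchSwinnertonDyer.BirchSwinnertonDyer.Theses.DerivedKatoValuationDoor.KatoMainConjecturePrimeTOfDoor :=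
  kato_mainConjecture_primeT_of_door_of_bcs_of_clause_of_h2 hBCS hX hH2

/-- **The item is DEFINITIONALLY the Literature named fact** `Kato2004.kato_mainConjecture_primeT_of_door` (the
route decl's body), recorded so that a future `_holds` of the fact closes the item by `Iff.rfl` transport.
[cite: Kato2004Asterisque, Conj. 12.10 (p. 224)] -/
theorem katoMainConjecturePrimeTOfDoor_iff :
    Summit.BirchSwinnertonDyer.BirchSwinnertonDyer.Theses.DerivedKatoValuationDoor.KatoMainConjecturePrimeTOfDoor ↔
      kato_mainConjecture_primeT_of_door :=
  Iff.rfl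

end Summit.BirchSwinnertonDyer.BirchSwinnertonDyer.Theorems.DerivedKatoValuationDoor

end
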